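import Literature.AlgebraicTopology.Homotopy.GlueSpheres
import Literature.AlgebraicTopology.SingularHomology.StdSimplexFaces
import Mathlib.Analysis.Convex.StdSimplex
import HarnessLib

/-!
# Based simplicial spheres and their classes in `πₖ(X, x₀)` ("hats")

Topic `Literature/AlgebraicTopology/Homotopy`, continuing `CompactlySupportedSpheres.lean`. A
singular `k`-simplex `g : Δᵏ → X` (`Δᵏ = stdSimplex ℝ (Fin (k + 1))`, as for the tree's
`SingularSimplex`) which sends the boundary `∂Δᵏ` (points with a vanishing barycentric
coordinate) to `x₀` — a *based simplicial sphere*, `IsBased x₀ g` — defines a class in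
`π_ k X x₀`. We realise it by a compactly supported sphere on `ℝᵏ`, WITHOUT choosing a
homeomorphism of pairs `(Iᵏ, ∂Iᵏ) ≅ (Δᵏ, ∂Δᵏ)`:

* `cornerSimplex k = {y : ℝᵏ | 0 ≤ yᵢ, ∑ yᵢ ≤ 1}`, identified with `Δᵏ` by the barycentric
  coordinates `baryCoords y = (1 - ∑ yᵢ, y₀, …, y_{k-1})` (`baryPt`, inverse `tailPt = Fin.tail`);
* `simplexRetr : ℝᵏ → cornerSimplex k`, the explicit retraction "clamp below at `0`, then divide
  by `max 1 ∑`", which sends every point outside the simplex to its boundary;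
* `CSphere.hat g hg : CSphere k X x₀`, **the hat of a based simplicial sphere**:
  `y ↦ g (baryPt (simplexRetr y))` — it is `g` (in barycentric coordinates) on the corner simplex
  and `x₀` outside; `hat_tailPt : hat g hg (tailPt s) = g s`;
* `CSphere.hat_homotopic`: based homotopies of `g` give homotopies of hats;
* `CSphere.exists_hat_toClass_eq`: **every class of `π_ k X x₀` is the class of a hat** (shrink a
  compactly supported representative into the interior of the corner simplex).

Everything is proved; `[folklore]` (Hatcher, *Algebraic Topology* (2002), §4.1, p. 340: spheres
as maps of `(Dᵏ, ∂Dᵏ)`, here with `Dᵏ` a simplex).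

Relation to the rest of the tree. `IsBased x₀ g` is, definitionally, the boundary condition
`∀ t ∈ SingularHomology.stdBoundary k, g t = x₀` of `SingularHomology/StdSimplexFaces.lean`
(`isBased_iff`, `Iff.rfl`). The tree also has the parallel device
`SingularHomology.HurewiczSimplexClass.simplexClass g hg : π_ n X x₀` (Spanier's `[α]`, through
the radial homeomorphism of pairs `cubeSimplexHomeo : (Iⁿ, ∂Iⁿ) ≅ (Δⁿ, ∂Δⁿ)`), with
`simplexClass_surjective` and `simplexClass_eq_iff_homotopicRel`. The present `hat` is the
`CSphere`-side analogue, built so that affine changes of coordinates of `ℝᵏ` can be tracked by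
`LinearActionSpheres` / `LinearActionSign`; the identity `(hat g hg).toClass = simplexClass g hg`
is NOT claimed here (the two identifications may differ by the orientation character of the
chart). The set `cornerSimplex k` is the same set as `Literature.NumberTheory.Sieve.maynardSimplex k`
(`MaynardTao.lean`), kept separate to avoid importing a sieve file into homotopy theory.

## References

* A. Hatcher, *Algebraic Topology*, CUP (2002), §4.1, p. 340. [HatcherAT2002]
-/

noncomputable section

open Set Metric unitInterval Topology
open scoped Topology.Homotopy

universe u

namespace Literature.AlgebraicTopology.Homotopy

variable {k : ℕ}

/-! ### The corner simplex and barycentric coordinates -/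

/-- The **corner simplex** `{y | 0 ≤ yᵢ, ∑ yᵢ ≤ 1} ⊆ ℝᵏ` (the same set as
`Literature.NumberTheory.Sieve.maynardSimplex k`; duplicated to avoid the import). [folklore] -/
def cornerSimplex (k : ℕ) : Set (Fin k → ℝ) := {y | (∀ i, 0 ≤ y i) ∧ ∑ i, y i ≤ 1}

/-- The corner simplex is closed. [folklore] -/
theorem isClosed_cornerSimplex : IsClosed (cornerSimplex k) := by
  have h : cornerSimplex k = (⋂ i, {y : Fin k → ℝ | 0 ≤ y i}) ∩ {y | ∑ i, y i ≤ 1} := by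
    ext y; simp [cornerSimplex]
  rw [h]
  exact (isClosed_iInter fun i => isClosed_le continuous_const (continuous_apply i)).inter
    (isClosed_le (by fun_prop) continuous_const)

/-- The corner simplex is convex. [folklore] -/
theorem convex_cornerSimplex : Convex ℝ (cornerSimplex k) := by
  have h : cornerSimplex k = (⋂ i, {y : Fin k → ℝ | 0 ≤ y i}) ∩ {y | ∑ i, y i ≤ 1} := by
    ext y; simp [cornerSimplex]
  rw [h]
  refine (convex_iInter fun i => ?_).inter ?_
  · exact convex_halfSpace_ge (LinearMap.proj i).isLinear 0
  · exact convex_halfSpace_le (IsLinearMap.mk (fun y z => by simp [Finset.sum_add_distrib])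
      (fun c y => by simp [Finset.mul_sum])) 1

/-- Points of the corner simplex have coordinates in `[0, 1]`, hence norm `≤ 1`. [folklore] -/
theorem norm_le_one_of_mem_cornerSimplex {y : Fin k → ℝ} (hy : y ∈ cornerSimplex k) : ‖y‖ ≤ 1 := by
  refine (pi_norm_le_iff_of_nonneg zero_le_one).2 fun i => ?_
  rw [Real.norm_eq_abs, abs_of_nonneg (hy.1 i)]
  exact (Finset.single_le_sum (fun j _ => hy.1 j) (Finset.mem_univ i)).trans hy.2

/-- **Barycentric coordinates** of a point of `ℝᵏ`: `(1 - ∑ yᵢ, y₀, …, y_{k-1})`. [folklore] -/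
def baryCoords (y : Fin k → ℝ) : Fin (k + 1) → ℝ := Fin.cons (1 - ∑ i, y i) y

/-- The zeroth barycentric coordinate. [folklore] -/
@[simp] theorem baryCoords_zero (y : Fin k → ℝ) : baryCoords y 0 = 1 - ∑ i, y i := by
  simp [baryCoords]

/-- The other barycentric coordinates. [folklore] -/
@[simp] theorem baryCoords_succ (y : Fin k → ℝ) (i : Fin k) : baryCoords y i.succ = y i := by
  simp [baryCoords]

/-- Barycentric coordinates sum to `1`. [folklore] -/
theorem sum_baryCoords (y : Fin k → ℝ) : ∑ i, baryCoords y i = 1 := by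
  rw [Fin.sum_univ_succ]; simp

/-- Barycentric coordinates are continuous. [folklore] -/
@[fun_prop]
theorem continuous_baryCoords : Continuous (baryCoords : (Fin k → ℝ) → Fin (k + 1) → ℝ) := by
  refine continuous_pi fun i => ?_
  refine Fin.cases ?_ (fun j => ?_) i
  · simp only [baryCoords_zero]; fun_prop
  · simp only [baryCoords_succ]; exact continuous_apply j

/-- On the corner simplex, barycentric coordinates lie in the standard simplex. [folklore] -/
theorem baryCoords_mem {y : Fin k → ℝ} (hy : y ∈ cornerSimplex k) :
    baryCoords y ∈ stdSimplex ℝ (Fin (k + 1)) := by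
  refine ⟨fun i => ?_, sum_baryCoords y⟩
  refine Fin.cases ?_ (fun j => ?_) i
  · rw [baryCoords_zero]; linarith [hy.2]
  · rw [baryCoords_succ]; exact hy.1 j

/-- **The point of the standard simplex** with given corner-simplex coordinates. [folklore] -/
def baryPt (y : Fin k → ℝ) (hy : y ∈ cornerSimplex k) : stdSimplex ℝ (Fin (k + 1)) :=
  ⟨baryCoords y, baryCoords_mem hy⟩

/-- Coordinates of `baryPt`. [folklore] -/
@[simp] theorem baryPt_apply (y : Fin k → ℝ) (hy : y ∈ cornerSimplex k) (i : Fin (k + 1)) :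
    baryPt y hy i = baryCoords y i := rfl

/-- **The corner-simplex coordinates** of a point of the standard simplex: drop the zeroth
barycentric coordinate. [folklore] -/
def tailPt (s : stdSimplex ℝ (Fin (k + 1))) : Fin k → ℝ := Fin.tail (⇑s)

/-- Coordinates of `tailPt`. [folklore] -/
@[simp] theorem tailPt_apply (s : stdSimplex ℝ (Fin (k + 1))) (i : Fin k) : tailPt s i = s i.succ := rfl

/-- `tailPt` is continuous. [folklore] -/
@[fun_prop]
theorem continuous_tailPt : Continuous (tailPt : stdSimplex ℝ (Fin (k + 1)) → Fin k → ℝ) :=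
  continuous_pi fun i => (continuous_apply i.succ).comp continuous_subtype_val

/-- `tailPt` lands in the corner simplex. [folklore] -/
theorem tailPt_mem (s : stdSimplex ℝ (Fin (k + 1))) : tailPt s ∈ cornerSimplex k := by
  refine ⟨fun i => stdSimplex.zero_le s i.succ, ?_⟩
  have h := stdSimplex.sum_eq_one s
  rw [Fin.sum_univ_succ] at h
  have h0 := stdSimplex.zero_le s 0
  simp only [tailPt_apply]
  linarith

/-- `baryPt ∘ tailPt = id`. [folklore] -/
@[simp] theorem baryPt_tailPt (s : stdSimplex ℝ (Fin (k + 1))) :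
    baryPt (tailPt s) (tailPt_mem s) = s := by
  apply stdSimplex.ext
  funext i
  refine Fin.cases ?_ (fun j => ?_) i
  · have h := stdSimplex.sum_eq_one s
    rw [Fin.sum_univ_succ] at h
    simp only [baryPt_apply, baryCoords_zero, tailPt_apply]
    linarith
  · simp

/-- `tailPt ∘ baryPt = id`. [folklore] -/
@[simp] theorem tailPt_baryPt (y : Fin k → ℝ) (hy : y ∈ cornerSimplex k) : tailPt (baryPt y hy) = y := by
  funext i; simp

/-- A point of the standard simplex has a vanishing barycentric coordinate iff it comes from the
"boundary" of the corner simplex: some coordinate `0`, or coordinate sum `1`. [folklore] -/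
theorem exists_baryPt_eq_zero_iff {y : Fin k → ℝ} (hy : y ∈ cornerSimplex k) :
    (∃ i, baryPt y hy i = 0) ↔ (∃ i, y i = 0) ∨ ∑ i, y i = 1 := by
  constructor
  · rintro ⟨i, hi⟩
    revert hi
    refine Fin.cases ?_ (fun j => ?_) i
    · intro h; right; simp at h; linarith
    · intro h; left; exact ⟨j, by simpa using h⟩
  · rintro (⟨i, hi⟩ | h)
    · exact ⟨i.succ, by simp [hi]⟩
    · exact ⟨0, by simp [h]⟩

/-! ### The retraction of `ℝᵏ` onto the corner simplex -/

/-- Clamping the coordinates below at `0`. [folklore] -/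
def clampNonneg (y : Fin k → ℝ) : Fin k → ℝ := fun i => max (y i) 0

/-- **The retraction onto the corner simplex**: clamp below at `0`, then divide by
`max 1 (∑ coordinates)`. [folklore] -/
def simplexRetr (y : Fin k → ℝ) : Fin k → ℝ :=
  (max 1 (∑ i, clampNonneg y i))⁻¹ • clampNonneg y

/-- The retraction is continuous. [folklore] -/
@[fun_prop]
theorem continuous_simplexRetr : Continuous (simplexRetr : (Fin k → ℝ) → Fin k → ℝ) := by
  have hc : Continuous (clampNonneg : (Fin k → ℝ) → Fin k → ℝ) :=
    continuous_pi fun i => (continuous_apply i).max continuous_const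
  have hs : Continuous fun y : Fin k → ℝ => max 1 (∑ i, clampNonneg y i) :=
    continuous_const.max (continuous_finsetSum _ fun i _ => (continuous_apply i).comp hc)
  unfold simplexRetr
  exact (hs.inv₀ fun y => (lt_of_lt_of_le one_pos (le_max_left _ _)).ne').smul hc

/-- The retraction lands in the corner simplex. [folklore] -/
theorem simplexRetr_mem (y : Fin k → ℝ) : simplexRetr y ∈ cornerSimplex k := by
  have hm : 0 < max 1 (∑ i, clampNonneg y i) := lt_of_lt_of_le one_pos (le_max_left _ _)
  refine ⟨fun i => ?_, ?_⟩
  · simp only [simplexRetr, Pi.smul_apply, smul_eq_mul]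
    exact mul_nonneg (inv_nonneg.2 hm.le) (le_max_right _ _)
  · simp only [simplexRetr, Pi.smul_apply, smul_eq_mul, ← Finset.mul_sum]
    rw [inv_mul_le_iff₀ hm, mul_one]
    exact le_max_right _ _

/-- The retraction is the identity on the corner simplex. [folklore] -/
theorem simplexRetr_of_mem {y : Fin k → ℝ} (hy : y ∈ cornerSimplex k) : simplexRetr y = y := by
  have hc : clampNonneg y = y := funext fun i => max_eq_left (hy.1 i)
  simp only [simplexRetr, hc, max_eq_left hy.2, inv_one, one_smul]

/-- **Outside the corner simplex the retraction hits the boundary**: some barycentric coordinate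
of the image vanishes. [folklore] -/
theorem exists_baryPt_simplexRetr_eq_zero {y : Fin k → ℝ} (hy : y ∉ cornerSimplex k) :
    ∃ i, baryPt (simplexRetr y) (simplexRetr_mem y) i = 0 := by
  rw [exists_baryPt_eq_zero_iff]
  by_cases h : ∀ i, 0 ≤ y i
  · -- all coordinates nonnegative, so the sum exceeds `1` and we normalise
    right
    have hc : clampNonneg y = y := funext fun i => max_eq_left (h i)
    have hs : 1 < ∑ i, y i := by
      by_contra hle; exact hy ⟨h, not_lt.1 hle⟩
    simp only [simplexRetr, hc, Pi.smul_apply, smul_eq_mul, ← Finset.mul_sum, max_eq_right hs.le]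
    exact inv_mul_cancel₀ (by linarith)
  · left
    obtain ⟨i, hi⟩ := not_forall.1 h
    have hi' : y i < 0 := not_le.1 hi
    refine ⟨i, ?_⟩
    simp only [simplexRetr, Pi.smul_apply, smul_eq_mul, clampNonneg, max_eq_right hi'.le, mul_zero]

/-! ### Based simplicial spheres and their hats -/

variable {X : Type u} [TopologicalSpace X]

/-- A singular simplex is a **based sphere** at `x₀` if it sends the boundary (the points with a
vanishing barycentric coordinate) to `x₀`. [folklore] -/
def IsBased (x₀ : X) (g : C(stdSimplex ℝ (Fin (k + 1)), X)) : Prop :=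
  ∀ s : stdSimplex ℝ (Fin (k + 1)), (∃ i, s i = 0) → g s = x₀

/-- `IsBased x₀ g` is the tree's boundary condition "`g = x₀` on `stdBoundary k`"
(`SingularHomology/StdSimplexFaces.lean`), definitionally. [folklore] -/
@[simp] theorem isBased_iff (x₀ : X) (g : C(stdSimplex ℝ (Fin (k + 1)), X)) :
    IsBased x₀ g ↔ ∀ t ∈ SingularHomology.stdBoundary k, g t = x₀ := Iff.rfl

namespace CSphere

variable {x₀ : X}

/-- **The hat** of a based simplicial sphere: the compactly supported sphere on `ℝᵏ` equal to `g`
(in barycentric coordinates) on the corner simplex and to `x₀` outside. [folklore] -/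
def hat (g : C(stdSimplex ℝ (Fin (k + 1)), X)) (hg : IsBased x₀ g) : CSphere k X x₀ :=
  ⟨fun y => g (baryPt (simplexRetr y) (simplexRetr_mem y)),
    g.continuous.comp (Continuous.subtype_mk (continuous_baryCoords.comp continuous_simplexRetr) _),
    ⟨2, fun y hy => hg _ (exists_baryPt_simplexRetr_eq_zero fun h =>
      absurd (norm_le_one_of_mem_cornerSimplex h) (by linarith))⟩⟩

/-- The hat on the corner simplex. [folklore] -/
theorem hat_apply_of_mem (g : C(stdSimplex ℝ (Fin (k + 1)), X)) (hg : IsBased x₀ g) {y : Fin k → ℝ}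
    (hy : y ∈ cornerSimplex k) : hat g hg y = g (baryPt y hy) := by
  show g _ = g _
  congr 1
  exact stdSimplex.ext (congrArg baryCoords (simplexRetr_of_mem hy))

/-- The hat off the corner simplex. [folklore] -/
theorem hat_apply_of_not_mem (g : C(stdSimplex ℝ (Fin (k + 1)), X)) (hg : IsBased x₀ g)
    {y : Fin k → ℝ} (hy : y ∉ cornerSimplex k) : hat g hg y = x₀ :=
  hg _ (exists_baryPt_simplexRetr_eq_zero hy)

/-- The hat at `tailPt s` is `g s`. [folklore] -/
@[simp] theorem hat_tailPt (g : C(stdSimplex ℝ (Fin (k + 1)), X)) (hg : IsBased x₀ g)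
    (s : stdSimplex ℝ (Fin (k + 1))) : hat g hg (tailPt s) = g s := by
  rw [hat_apply_of_mem g hg (tailPt_mem s), baryPt_tailPt]

/-- **Based homotopies give homotopies of hats**: a jointly continuous family `G t` of based
simplicial spheres yields homotopic hats at `t = 0` and `t = 1`. (The family is indexed by
`t ∈ ℝ`, as in `homotopic_of_family`; a homotopy on `[0, 1]` is first extended by
`Set.projIcc`.) [folklore] -/
theorem hat_homotopic (G : ℝ → C(stdSimplex ℝ (Fin (k + 1)), X))
    (hG : Continuous fun p : stdSimplex ℝ (Fin (k + 1)) × ℝ => G p.2 p.1)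
    (hGb : ∀ t, IsBased x₀ (G t)) : Homotopic (hat (G 0) (hGb 0)) (hat (G 1) (hGb 1)) := by
  refine homotopic_of_family (fun t => hat (G t) (hGb t)) ?_ 2 fun t _ y hy => ?_
  · exact hG.comp ((Continuous.subtype_mk (continuous_baryCoords.comp
      (continuous_simplexRetr.comp continuous_fst)) _).prodMk continuous_snd)
  · exact hGb t _ (exists_baryPt_simplexRetr_eq_zero fun h =>
      absurd (norm_le_one_of_mem_cornerSimplex h) (by linarith))

/-! ### Every class is the class of a hat -/

/-- The centre `(1/(k+1), …, 1/(k+1))` of the corner simplex. [folklore] -/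
def cornerCenter (k : ℕ) : Fin k → ℝ := fun _ => ((k : ℝ) + 1)⁻¹

/-- The key inequality `k ((k+1)⁻¹ + (k+1)⁻²) < 1`. [folklore] -/
theorem cornerCenter_ineq (k : ℕ) : (k : ℝ) * (((k : ℝ) + 1)⁻¹ + (((k : ℝ) + 1)⁻¹) ^ 2) < 1 := by
  set a : ℝ := ((k : ℝ) + 1)⁻¹ with ha
  have hk1 : (0 : ℝ) < (k : ℝ) + 1 := by positivity
  have ha0 : 0 < a := inv_pos.2 hk1
  have hka : (k : ℝ) * a = 1 - a := by
    have : ((k : ℝ) + 1) * a = 1 := mul_inv_cancel₀ hk1.ne'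
    linarith
  calc (k : ℝ) * (a + a ^ 2) = ((k : ℝ) * a) * (1 + a) := by ring
    _ = (1 - a) * (1 + a) := by rw [hka]
    _ = 1 - a ^ 2 := by ring
    _ < 1 := by nlinarith

/-- The sup-ball of radius `1/(k+1)²` about the centre lies in the corner simplex, for `k ≥ 1`
(`k = 0`, where `ℝ⁰` is a point, is omitted only for convenience). [folklore] -/
theorem ball_cornerCenter_subset [NeZero k] :
    ball (cornerCenter k) (((k : ℝ) + 1)⁻¹ ^ 2) ⊆ cornerSimplex k := by
  intro y hy
  rw [mem_ball, dist_pi_lt_iff (by positivity)] at hy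
  have hk : (1 : ℝ) ≤ k := by exact_mod_cast NeZero.one_le
  have hk1 : (0 : ℝ) < (k : ℝ) + 1 := by positivity
  have hcoord : ∀ i, |y i - ((k : ℝ) + 1)⁻¹| < ((k : ℝ) + 1)⁻¹ ^ 2 := fun i => by
    have := hy i; rwa [Real.dist_eq] at this
  have hsq : ((k : ℝ) + 1)⁻¹ ^ 2 ≤ ((k : ℝ) + 1)⁻¹ := by
    rw [sq]
    refine mul_le_of_le_one_right (inv_nonneg.2 hk1.le) ?_
    rw [inv_le_one₀ hk1]; linarith
  refine ⟨fun i => ?_, ?_⟩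
  · have := abs_lt.1 (hcoord i)
    linarith
  · calc ∑ i, y i ≤ ∑ _i : Fin k, (((k : ℝ) + 1)⁻¹ + ((k : ℝ) + 1)⁻¹ ^ 2) :=
          Finset.sum_le_sum fun i _ => by linarith [(abs_lt.1 (hcoord i)).2]
      _ = k * (((k : ℝ) + 1)⁻¹ + ((k : ℝ) + 1)⁻¹ ^ 2) := by
          rw [Finset.sum_const, Finset.card_univ, Fintype.card_fin, nsmul_eq_mul]
      _ ≤ 1 := (cornerCenter_ineq k).le

/-- **Every class of `π_ k X x₀` is the class of a hat** (`k ≥ 1`; the trivial case `k = 0` is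
omitted only for convenience): shrink a compactly supported representative into the small ball
about the centre of the corner simplex, and read it in barycentric coordinates. [folklore] -/
theorem exists_hat_toClass_eq [NeZero k] (a : π_ k X x₀) :
    ∃ (g : C(stdSimplex ℝ (Fin (k + 1)), X)) (hg : IsBased x₀ g), (hat g hg).toClass = a := by
  obtain ⟨φ, rfl⟩ := toClass_surjective a
  obtain ⟨R, hR0, hR⟩ := φ.exists_bound_nonneg
  set c := cornerCenter k with hc
  set δ : ℝ := ((k : ℝ) + 1)⁻¹ ^ 2 with hδ
  have hδ0 : 0 < δ := by positivity
  set t : ℝ := δ / (R + ‖c‖ + 1) with ht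
  have hden : 0 < R + ‖c‖ + 1 := by positivity
  have ht0 : 0 < t := div_pos hδ0 hden
  set ψ := homothety φ c t ht0 with hψ
  -- the shrunk sphere is supported in the ball `ball c δ ⊆ cornerSimplex k`
  have hsupp : ∀ y, ψ y ≠ x₀ → y ∈ ball c δ := by
    intro y hy
    rw [hψ, homothety_apply] at hy
    have h1 : ‖c + t⁻¹ • (y - c)‖ < R := by
      by_contra hcon; exact hy (hR _ (not_lt.1 hcon))
    have h2 := le_norm_homothetyInv c y ht0
    have h3 : t⁻¹ * ‖y - c‖ < R + ‖c‖ := by linarith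
    rw [← div_eq_inv_mul, div_lt_iff₀ ht0] at h3
    rw [mem_ball, dist_eq_norm]
    calc ‖y - c‖ < (R + ‖c‖) * t := h3
      _ < (R + ‖c‖ + 1) * t := mul_lt_mul_of_pos_right (by linarith) ht0
      _ = δ := by rw [ht]; field_simp
  have hsupp' : ∀ y, y ∉ ball c δ → ψ y = x₀ := fun y hy => by
    by_contra h; exact hy (hsupp y h)
  -- the based simplicial sphere `g = ψ ∘ tailPt`
  let g : C(stdSimplex ℝ (Fin (k + 1)), X) := ⟨fun s => ψ (tailPt s), ψ.continuous.comp continuous_tailPt⟩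
  have hg : IsBased x₀ g := by
    intro s hs
    apply hsupp'
    intro hball
    have hmem := (exists_baryPt_eq_zero_iff (tailPt_mem s)).1 (by
      obtain ⟨i, hi⟩ := hs
      exact ⟨i, by rw [baryPt_tailPt]; exact hi⟩)
    rw [mem_ball, dist_pi_lt_iff hδ0] at hball
    have hk1 : (0 : ℝ) < (k : ℝ) + 1 := by positivity
    have hsq : δ < ((k : ℝ) + 1)⁻¹ := by
      rw [hδ, sq]
      have hk : (1 : ℝ) ≤ k := by exact_mod_cast NeZero.one_le
      calc ((k : ℝ) + 1)⁻¹ * ((k : ℝ) + 1)⁻¹ < ((k : ℝ) + 1)⁻¹ * 1 := by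
            gcongr; rw [inv_lt_one₀ hk1]; linarith
        _ = _ := mul_one _
    rcases hmem with ⟨i, hi⟩ | hsum
    · have := hball i
      rw [Real.dist_eq, tailPt_apply] at this
      simp only [hc, cornerCenter] at this
      rw [show s i.succ = 0 from hi, zero_sub, abs_neg, abs_of_pos (inv_pos.2 hk1)] at this
      linarith
    · -- coordinate sum `1` is too large for the ball
      have hle : ∑ i, tailPt s i ≤ ∑ _i : Fin k, (((k : ℝ) + 1)⁻¹ + δ) :=
        Finset.sum_le_sum fun i _ => by
          have := hball i; rw [Real.dist_eq] at this
          simp only [hc, cornerCenter] at this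
          linarith [(abs_lt.1 this).2]
      rw [hsum, Finset.sum_const, Finset.card_univ, Fintype.card_fin, nsmul_eq_mul] at hle
      have : (k : ℝ) * (((k : ℝ) + 1)⁻¹ + δ) < 1 := by rw [hδ]; exact cornerCenter_ineq k
      linarith
  refine ⟨g, hg, ?_⟩
  -- `hat g = ψ`, and shrinking did not change the class
  have hhat : hat g hg = ψ := by
    refine ext fun y => ?_
    by_cases hy : y ∈ cornerSimplex k
    · rw [hat_apply_of_mem g hg hy]
      show ψ (tailPt (baryPt y hy)) = ψ y
      rw [tailPt_baryPt]
    · rw [hat_apply_of_not_mem g hg hy]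
      exact (hsupp' y fun h => hy (ball_cornerCenter_subset h)).symm
  rw [hhat, hψ, toClass_homothety]

end CSphere

end Literature.AlgebraicTopology.Homotopy

end
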